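import Summits.HodgeConjecture.HodgeConjecture.Theorems.Ring2AbelianAllSpreadFloorUnderAndre
import Summits.HodgeConjecture.HodgeConjecture.Theorems.Ring2AbelianAllAndreStandardALieberman
import Summits.HodgeConjecture.HodgeConjecture.Theorems.Ring2AbelianAllStandardAPencilsHomNum
import Summits.HodgeConjecture.HodgeConjecture.Theorems.Ring2AbelianAllAndreSpreadNumerical
import Literature.AlgebraicGeometry.HodgeTheory.SpreadAlgebraicClassesOverCurve
import Summits.HodgeConjecture.HodgeConjecture.Theorems.Ring2AbelianAllAndreSpreadVerdierGraded
import HarnessLib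

/-!
# Ring 2 · §AbelianAll (seat `ab-spread-1`), XII — THE NUMERICAL AXIS UNDER THE FLOOR, `HC_CM`-FREE:
# `Num^CM ⟹[Lieberman] (L) ⟹[Lemme 6.3.1] F_CM`, hence `HomNum_pen^CM ⟹ A_pen^CM ⟹ Num^CM ⟹ F_CM` with the
# Abdulali fact of part XI replaced by Lieberman's theorem; rev 2 (§5): granted the classical curve-base spreading fact,
# UNDER `HC_CM` THE FLOOR IS THE NUMERICAL NODE — `F_CM ⟺ Num^CM ⟺ (L) ⟺ (L∀)` mod [h₂₁, Spread]; rev 3 (§6): the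
# same rows RE-KEYED to Verdier's generic local triviality — mod [h₂₁, Verdier] — after ab-andre-2's parts XX-a/b
# (the André axis's spreading input is a theorem modulo Verdier 1976 on its carriers; count once, theirs)

HONEST FRAMING: research route, not a corollary; conditional on HC_CM plus one named minimal statement.
(Cell line: research route conditional on HC_CM; not a corollary; Q11.4-sentence-2 already refuted in dim ≥ 3.)
Nothing in this file is a case of the Hodge conjecture. `HC_CM` = `Theses.RankFourFaces.CMAbelianHodge` is a BINDER in
the rows of §4–§5 that mention it and absent elsewhere; `HC_AV` = `Theses.PadicSemiregularLift.HodgeAbelianVarieties`;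
the item `Theses.RankFourFaces.CMToAbelian` (stmt-HodgeConjecture-16267) stays OPEN. No definition, no new named fact,
no sorry. The one printed input displayed as a hypothesis is Lieberman's theorem `B(A)` for complex abelian varieties,
`hL : Literature.AlgebraicGeometry.HodgeTheory.Lieberman1968_lefschetzInvolution_algebraic_abelianVariety` (Lieberman
1968; Kleiman 1968, 2A11), exactly as in seat ab-andre-2's part XVIII-e; André's Lemme 6.3.1 is the binder `h₂₁` as in
part XI; §5 (rev 2) displays one more named fact, the classical curve-base spreading of fibrewise algebraic classes
`hSp : Literature.AlgebraicGeometry.HodgeTheory.spread_algebraicClasses_over_smoothCurve` (ab-andre-2's hypothesis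
shape `SpreadCurve[]` of parts XIX-a/b, by name as in their XIX-d; D-0026 debt, never discharged here); §6 (rev 3)
displays instead Verdier's generic local triviality `hGT : Literature.AlgebraicGeometry.Motives.Verdier1976_genericLocalTriviality`
(Verdier 1976, Thm. (3.3), (4.14), Cor. (5.1); a named published fact ALREADY load-bearing in the tree, by name as in
ab-andre-2's parts XX-a/b; never discharged here).
The nodes Num^CM = `CMPointedPencilNumerical` (ab-andre-2, XVIII-c), (L) = `CMFibreAlgebraicLift` (ab-andre-2,
part I; on path by part VI), A_pen^CM / A_pen∀ = `CMPointedPencilStandardA` / `CompactAbelianPencilStandardA` (ab-andre-1,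
XIV) are used BY NAME — nothing is re-typed; "hom ≡ num on the CM-pointed total spaces" is ab-andre-1's DISPLAYED hypothesis of part
XIV-d (`cmPointedPencilStandardA_of_homNum`), copied verbatim as a binder (no `def`).

## Why this file (part XI, row (d) deferred there: the numerical node)

Part XI (`Ring2AbelianAllSpreadFloorUnderAndre`) put the spread floor F_CM = `HodgeFailureSpreadsToCMFibre` below every
André-axis node by one-name rows, the standard-conjecture rows modulo the Abdulali fact `h₈A` and `h₂₁`; its header (d)
deferred the numerical node until seat ab-andre-2's `def` landed. That `def` is now in the tree (XVIII-c,
`CMPointedPencilNumerical`: Grothendieck's `D` — "hom ≡ num" — for the cycles of the total space supported on a CM fibre).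
Ab-andre-2 closes Num^CM WITH `HC_CM`
(`HC_AV_of_HC_CM_of_cmPointedPencilNumerical`, the fibre's perfect pairing coming from Hodge theory at a CM fibre under
`HC_CM`), and proves (XVIII-e `nondegenerate_fiberOver_of_lieberman`) that Lieberman's theorem gives that perfect pairing
(Perf_t) on EVERY fibre of a compact abelian pencil, unconditionally in `HC_CM`. Putting the two next to part XVIII-a's
lift `cmFibreAlgebraicLift_of_nondegenerate_of_numerical` gives the row this seat owes, with `HC_CM` nowhere:

  Num^CM ⟹[hL] (L) ⟹[h₂₁] F_CM,

and, by ab-andre-2's `cmPointedPencilNumerical_of_cmPointedPencilStandardA` (Kleiman `A ⇒ D`, XVIII-d/e) and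
ab-andre-1's `cmPointedPencilStandardA_of_homNum` (Kleiman `D ⇒ A`, XIV-d), the whole numerical / Lefschetz-`A` column

  HomNum_pen^CM ⟹ A_pen^CM ⟹ Num^CM ⟹[hL] (L) ⟹[h₂₁] F_CM ⟹ CMToAbelian,

so the `h₈A` of part XI's standard-conjecture rows is replaced by the refereed classical fact `hL`.

## What is proved

§1 `cmFibreAlgebraicLift_of_lieberman_of_cmPointedPencilNumerical` : `hL → Num^CM → (L)` (the `HC_CM`-free lift).
§2 floor rows, all `HC_CM`-free, K[hL, h₂₁]: `hodgeFailureSpreadsToCMFibre_of_lieberman_of_andre1996_of_cmPointedPencilNumerical`,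
   `…_of_cmPointedPencilStandardA`, `…_of_compactAbelianPencilStandardA`, `…_of_homNumCMPointed`; the table
   `spreadFloor_below_numericalAxis`.
§3 junction rows through `HC_AV` with NO Abdulali fact and NO Lieberman (ab-andre-1 XIV-d ∘ ab-andre-2 XVIII-e, count once,
   both theirs): `HC_AV_of_andre1996_of_HC_CM_of_homNumCMPointed` (`h₂₁ → HC_CM → [hom ≡ num on CM-pointed total spaces] → HC_AV`;
   compare XIV-d's row, which carries `h₈A`).
§4 the trivial direction under `HC_CM` by name (`hodgeFailureSpreadsToCMFibre_of_andre1996_of_HC_CM_of_cmPointedPencilNumerical`).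
§5 (rev 2) granted the spreading fact `hSp` BY NAME (ab-andre-2 XIX-a/b composed with part VII and LEAD's Frame grammar;
   count once — theirs): `exactWithCM_liftNodes_of_andre1996_of_spread` (Num^CM, (L), (L∀) are `ExactWithCM`, K[h₂₁, Spread]);
   the converse row `cmPointedPencilNumerical_of_spread_of_HC_CM_of_hodgeFailureSpreadsToCMFibre` (`hSp → HC_CM → F_CM → Num^CM`);
   `hodgeFailureSpreadsToCMFibre_iff_cmPointedPencilNumerical_of_andre1996_of_spread_of_HC_CM` (`F_CM ↔ Num^CM` under `HC_CM`);
   `floor_iff_liftNodes_of_andre1996_of_spread_of_HC_CM` (part XI §C's exact-node list EXTENDED by Num^CM, (L), (L∀));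
   `modCM_hodgeFailureSpreadsToCMFibre_iff_modCM_cmPointedPencilNumerical_of_andre1996_of_spread` (the item, two readings);
   `bminFrontier_of_lieberman_of_andre1996_of_spread` (the B_min frontier of record {F_CM, Num^CM}: ORDERED `HC_CM`-free,
   COLLAPSED under `HC_CM`).
§6 (rev 3) the four §5 compositions RE-KEYED to Verdier `hGT` BY NAME (ab-andre-2 XX-a/b, landed 2026-08-20T22:0xZ; count
   once — theirs; `F_CM ↔ Num^CM` under `HC_CM` granted Verdier IS their XX-b §5 theorem, called by name):
   `exactWithCM_liftNodes_of_andre1996_of_verdier`, `floor_iff_liftNodes_of_andre1996_of_verdier_of_HC_CM`,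
   `modCM_…_of_andre1996_of_verdier`, `bminFrontier_of_lieberman_of_andre1996_of_verdier` (frontier of record mod {hL, h₂₁, Verdier}).

## What is NOT claimed (honest column)

(a) No `HC_CM`-FREE converse: `F_CM ⟹ Num^CM` is NOT proved without `HC_CM` (F_CM is vacuous given `HC_AV`, part VII;
Num^CM is on-path from `HC_AV` only through Hodge theory of the fibres and spreading). UNDER `HC_CM` the converse HOLDS
granted the classical spreading fact `hSp` (§5, rev 2): ab-andre-2's parts XIX-a/b (`Ring2AbelianAllAndreSpreadLift`,
`Ring2AbelianAllAndreSpreadNumerical`) prove `(4) ⟺ (L)`, `HC_AV ⟹ (L)` and `HC_AV ⟺ HC_CM ∧ Num^CM` modulo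
[h₂₁, Spread], so Num^CM, (L), (L∀) ARE exact complements of `HC_CM` and §5 lists them next to part XI §C's exact nodes
by NEW theorems (part XI is untouched). FACT-FREE — without `hSp` — `(4) ⟹ (L)` and this converse stay unproved in the
tree. Rev 1 of this file (2026-08-20T21:03Z) wrote "(4) ⟹ (L) is open … so Num^CM is NOT added to part XI §C's list"
without the qualifier 'fact-free', although XIX-a/b had landed (20:07Z / 20:30Z); rev 2 corrects that record — no
statement of §1–§4 is changed. (b) "smaller" means: F_CM is below Num^CM in the preorder of landed kernel edges
modulo [hL, h₂₁]; under `HC_CM` the two COINCIDE modulo [h₂₁, Spread] (§5); 'minimal' is claimed for nothing (F-ab-4,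
F-ab-81) — exact is not minimal as a statement. (c) Lieberman's theorem is a named published fact
displayed as a hypothesis, never discharged here; no instance of Num^CM, A_pen, or hom ≡ num is proved here (the
unconditional corners and low relative dimensions are ab-andre-2's XVIII-g and XVIII-i and ab-andre-1's XIV-c). (d) B_min of
record for the cell is unchanged (F_CM, part VII); the B_min frontier of record {F_CM, Num^CM} (REFEREE-AB R-43 (iii)) is
placed in the kernel by §5, nothing more. (e) Nothing in §5 is fact-free: edge labels K[h₂₁, Spread] / K[Spread]; the
content of §5 is ab-andre-2's (XIX-a/b), part VII's and LEAD's Frame — new here are the compositions (count once).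
(f) §6 (rev 3): ab-andre-2's XX-a/b prove the André axis's spreading INPUT (the algebraic partie fixe on a smooth projective
family over a smooth projective curve, `exists_algebraic_lift_of_verdier`) from Verdier's generic local triviality `hGT`
alone, so every K[Spread] row of §5 has a K[Verdier] twin; §6 writes the twins of this file's four §5 compositions and CALLS
their XX-b §5 `hodgeFailureSpreadsToCMFibre_iff_cmPointedPencilNumerical_of_HC_CM_of_verdier` for the converse (count once:
theirs). Labels K[h₂₁, Verdier] / K[hL, h₂₁, Verdier]; NOTHING in §6 is fact-free; Verdier is a named published fact, never
discharged here; `hSp` itself is NOT derived from Verdier (XX-a header), so §5 stays (true, off the shortest path); the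
tree's FACTS list is unchanged; §1–§5 byte-identical to rev 2; 'minimal' claimed for nothing; B_min of record F_CM unchanged.

References (bib keys): Lieberman1968 (main theorem); Kleiman1968AlgebraicCycles (2A11, §3 Thm. 3.5, Cor. 3.9);
Andre1996Motifs (Lemme 6.3.1 p. 31, §6.3 Remarque 2 p. 33); Abdulali1994FamiliesAV (p. 1122); Milne2020HodgeClassesAV
(Prop. 1 p. 7); Grothendieck1968 (§3 p. 196); for the spreading fact (classical; see the PROOF of [VoisinHodgeII2003,
Thm. 10.19, §10.2.1 with §3.3.1] and [CharlesSchnell2014Notes, proof of Prop. 11.3.11, Cor. 11.3.6] — never the theorems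
themselves); Verdier1976 (Thm. (3.3), (4.14), Cor. (5.1)) and Dimca1992 (Ch. 1 (3.5)–(3.6)) for §6's displayed fact.
-/

set_option linter.dupNamespace false

namespace Summit.HodgeConjecture.HodgeConjecture.Ring2.AbelianAll

open CategoryTheory
open Literature.AlgebraicGeometry Literature.AlgebraicGeometry.Motives
open Literature.AlgebraicGeometry.HodgeTheory
open Literature.AlgebraicTopology.SingularHomology (cupProduct)
open Literature.AlgebraicGeometry.Deligne1982 (cmLocus)
open Literature.AlgebraicGeometry.Andre1996 (andre1996_cmAnchoredPencil)
open Summit.HodgeConjecture.HodgeConjecture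
open Summit.HodgeConjecture.HodgeConjecture.Theses
open Summit.HodgeConjecture.HodgeConjecture.Theses.RankFourFaces (CMAbelianHodge CMToAbelian)
open Summit.HodgeConjecture.HodgeConjecture.Theses.PadicSemiregularLift (HodgeAbelianVarieties)

/-! ## §1 The `HC_CM`-free lift: Num^CM and Lieberman give (L) -/

/-- **`hL → Num^CM → (L)`.** On a compact pencil of abelian `d`-folds, at a CM point `t` and in bidegree `p + q = d`,
part XVIII-a's lift needs (Perf_t) — the cup pairing `N^p(𝒳_t) × N^q(𝒳_t) → H^{2d}(𝒳_t)` non-degenerate on both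
sides — and (Num_t). Lieberman's theorem supplies (Perf_t) at EVERY fibre (ab-andre-2 XVIII-e
`nondegenerate_fiberOver_of_lieberman`: `B(A) ⇒ A(A, η) ⇒ D(A)` on the abelian fibre, transported along `𝒳_t ≅ A`), and
Num^CM is (Num_t) at the CM points. `HC_CM` does not occur. [cite: Lieberman1968, main theorem]
[cite: Kleiman1968AlgebraicCycles, §3 Cor. 3.9] [cite: Milne2020HodgeClassesAV, Prop. 1 (p. 7)] -/
theorem cmFibreAlgebraicLift_of_lieberman_of_cmPointedPencilNumerical
    (hL : Lieberman1968_lefschetzInvolution_algebraic_abelianVariety) (hNum : CMPointedPencilNumerical) :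
    CMFibreAlgebraicLift := by
  refine cmFibreAlgebraicLift_of_nondegenerate_of_numerical ?_
  intro d 𝒳 S f hf t ht p q hpq
  exact ⟨(nondegenerate_fiberOver_of_lieberman hL hf t hpq).1, (nondegenerate_fiberOver_of_lieberman hL hf t hpq).2,
    hNum f hf t ht p q hpq⟩

/-! ## §2 The numerical / Lefschetz-`A` column under the floor, `HC_CM`-free, modulo [hL, h₂₁] -/

/-- **Num^CM ⟹ F_CM mod Lieberman and Lemme 6.3.1** (§1, then part XI's `(L) ⟹[h₂₁] F_CM`).
[cite: Lieberman1968, main theorem] [cite: Andre1996Motifs, Lemme 6.3.1 (p. 31)] -/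
theorem hodgeFailureSpreadsToCMFibre_of_lieberman_of_andre1996_of_cmPointedPencilNumerical
    (hL : Lieberman1968_lefschetzInvolution_algebraic_abelianVariety) (h₂₁ : andre1996_cmAnchoredPencil)
    (hNum : CMPointedPencilNumerical) : HodgeFailureSpreadsToCMFibre :=
  hodgeFailureSpreadsToCMFibre_of_andre1996_of_cmFibreAlgebraicLift h₂₁
    (cmFibreAlgebraicLift_of_lieberman_of_cmPointedPencilNumerical hL hNum)

/-- **A_pen^CM ⟹ F_CM mod Lieberman and Lemme 6.3.1** — part XI's row
`hodgeFailureSpreadsToCMFibre_of_abdulaliA_of_andre1996_of_cmPointedPencilStandardA` with the Abdulali fact `h₈A` replaced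
by `hL` (ab-andre-2 XVIII-e: A_pen^CM ⟹ Num^CM, Kleiman `A ⇒ D` on the total space). [cite: Lieberman1968, main theorem]
[cite: Kleiman1968AlgebraicCycles, §3 Cor. 3.9] [cite: Andre1996Motifs, Lemme 6.3.1 (p. 31)] -/
theorem hodgeFailureSpreadsToCMFibre_of_lieberman_of_andre1996_of_cmPointedPencilStandardA
    (hL : Lieberman1968_lefschetzInvolution_algebraic_abelianVariety) (h₂₁ : andre1996_cmAnchoredPencil)
    (hA : CMPointedPencilStandardA) : HodgeFailureSpreadsToCMFibre :=
  hodgeFailureSpreadsToCMFibre_of_lieberman_of_andre1996_of_cmPointedPencilNumerical hL h₂₁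
    (cmPointedPencilNumerical_of_cmPointedPencilStandardA hA)

/-- **A_pen∀ ⟹ F_CM mod Lieberman and Lemme 6.3.1** (A_pen∀ ⟹ A_pen^CM, ab-andre-1 XIV).
[cite: Lieberman1968, main theorem] [cite: Andre1996Motifs, Lemme 6.3.1 (p. 31) and §6.3 Remarque 2 (p. 33)] -/
theorem hodgeFailureSpreadsToCMFibre_of_lieberman_of_andre1996_of_compactAbelianPencilStandardA
    (hL : Lieberman1968_lefschetzInvolution_algebraic_abelianVariety) (h₂₁ : andre1996_cmAnchoredPencil)
    (hA : CompactAbelianPencilStandardA) : HodgeFailureSpreadsToCMFibre :=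
  hodgeFailureSpreadsToCMFibre_of_lieberman_of_andre1996_of_cmPointedPencilStandardA hL h₂₁
    (cmPointedPencilStandardA_of_compactAbelianPencilStandardA hA)

/-- **HomNum_pen^CM ⟹ F_CM mod Lieberman and Lemme 6.3.1**: "hom ≡ num ⊗ ℂ for the algebraic classes of codimension
`q > (d+1)/2`, tested against codimension `p ≥ 2`, on the total space of every CM-pointed compact abelian pencil" — the
displayed hypothesis of ab-andre-1's `cmPointedPencilStandardA_of_homNum` (part XIV-d, Kleiman `D ⇒ A`), verbatim — lies
above the floor. [cite: Kleiman1968AlgebraicCycles, §3 Thm. 3.5] [cite: Lieberman1968, main theorem]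
[cite: Andre1996Motifs, Lemme 6.3.1 (ii) (p. 31)] -/
theorem hodgeFailureSpreadsToCMFibre_of_lieberman_of_andre1996_of_homNumCMPointed
    (hL : Lieberman1968_lefschetzInvolution_algebraic_abelianVariety) (h₂₁ : andre1996_cmAnchoredPencil)
    (hD : ∀ ⦃d : ℕ⦄ ⦃𝒳 S : SchemeOver ℂ⦄ (f : 𝒳 ⟶ S), IsCompactAbelianPencil f d → (cmLocus f d).Nonempty →
      ∀ (p q : ℕ) (hpq : p + q = d + 1) (_ : 2 ≤ p) (_ : p < q), ∀ y ∈ algebraicClasses 𝒳 q,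
        (∀ x ∈ algebraicClasses 𝒳 p, cupProduct (show 2 * p + 2 * q = 2 * (d + 1) by omega) x y = 0) → y = 0) :
    HodgeFailureSpreadsToCMFibre :=
  hodgeFailureSpreadsToCMFibre_of_lieberman_of_andre1996_of_cmPointedPencilStandardA hL h₂₁
    (cmPointedPencilStandardA_of_homNum hD)

/-- **The numerical / Lefschetz-`A` column lies above the floor, modulo [hL, h₂₁] only** (four rows; the (L) row is part
XI's, modulo `h₂₁` alone). 'Smaller' = below in the preorder of landed kernel edges modulo the displayed facts; 'minimal'
is claimed for nothing. [cite: Lieberman1968, main theorem] [cite: Andre1996Motifs, Lemme 6.3.1 (p. 31)] -/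
theorem spreadFloor_below_numericalAxis (hL : Lieberman1968_lefschetzInvolution_algebraic_abelianVariety)
    (h₂₁ : andre1996_cmAnchoredPencil) :
    (CMPointedPencilNumerical → HodgeFailureSpreadsToCMFibre) ∧ (CMFibreAlgebraicLift → HodgeFailureSpreadsToCMFibre) ∧
      (CMPointedPencilStandardA → HodgeFailureSpreadsToCMFibre) ∧
      (CompactAbelianPencilStandardA → HodgeFailureSpreadsToCMFibre) :=
  ⟨hodgeFailureSpreadsToCMFibre_of_lieberman_of_andre1996_of_cmPointedPencilNumerical hL h₂₁,
    hodgeFailureSpreadsToCMFibre_of_andre1996_of_cmFibreAlgebraicLift h₂₁,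
    hodgeFailureSpreadsToCMFibre_of_lieberman_of_andre1996_of_cmPointedPencilStandardA hL h₂₁,
    hodgeFailureSpreadsToCMFibre_of_lieberman_of_andre1996_of_compactAbelianPencilStandardA hL h₂₁⟩

/-- **The item reading, `HC_CM`-free and Abdulali-free: `hL → h₂₁ → Num^CM → CMToAbelian`** (stmt-HodgeConjecture-16267 stays
OPEN; compare ab-andre-2's `cmToAbelian_of_andre1996_of_cmPointedPencilNumerical`, which needs `h₂₁` only because the item's
own hypothesis `HC_CM` supplies (Perf) at CM fibres — the lighter row; this one is recorded for the fact-column comparison).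
[cite: Lieberman1968, main theorem] [cite: Andre1996Motifs, Remarque 2 (p. 33)] -/
theorem cmToAbelian_of_lieberman_of_andre1996_of_cmPointedPencilNumerical
    (hL : Lieberman1968_lefschetzInvolution_algebraic_abelianVariety) (h₂₁ : andre1996_cmAnchoredPencil)
    (hNum : CMPointedPencilNumerical) : CMToAbelian :=
  cmToAbelian_of_perClassFloor.1
    (hodgeFailureSpreadsToCMFibre_of_lieberman_of_andre1996_of_cmPointedPencilNumerical hL h₂₁ hNum)

/-! ## §3 Junction rows through `HC_AV` (ab-andre-1 XIV-d ∘ ab-andre-2 XVIII-e; count once, both theirs) -/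

/-- **`h₂₁ → HC_CM → [hom ≡ num on the CM-pointed total spaces] → HC_AV` with NO Abdulali fact and NO Lieberman**:
ab-andre-1's part XIV-d row `HC_AV_of_abdulaliA_of_andre1996_of_HC_CM_of_homNumCMPointed` carries `h₈A`; composing XIV-d's
`cmPointedPencilStandardA_of_homNum` (Kleiman `D ⇒ A`) with ab-andre-2's `HC_AV_of_HC_CM_of_cmPointedPencilStandardA`
(XVIII-e: Kleiman `A ⇒ D` on the total space, Hodge theory at the CM fibre under `HC_CM`, the lift) drops it. `HC_CM`, `h₂₁`
BINDERS. research route, not a corollary; conditional on HC_CM plus one named minimal statement.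
[cite: Kleiman1968AlgebraicCycles, §3 Thm. 3.5 and Cor. 3.9] [cite: Andre1996Motifs, Lemme 6.3.1 (p. 31) and §6.3 (p. 33)] -/
theorem HC_AV_of_andre1996_of_HC_CM_of_homNumCMPointed (h₂₁ : andre1996_cmAnchoredPencil) (hCM : CMAbelianHodge)
    (hD : ∀ ⦃d : ℕ⦄ ⦃𝒳 S : SchemeOver ℂ⦄ (f : 𝒳 ⟶ S), IsCompactAbelianPencil f d → (cmLocus f d).Nonempty →
      ∀ (p q : ℕ) (hpq : p + q = d + 1) (_ : 2 ≤ p) (_ : p < q), ∀ y ∈ algebraicClasses 𝒳 q,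
        (∀ x ∈ algebraicClasses 𝒳 p, cupProduct (show 2 * p + 2 * q = 2 * (d + 1) by omega) x y = 0) → y = 0) :
    HodgeAbelianVarieties :=
  HC_AV_of_HC_CM_of_cmPointedPencilStandardA h₂₁ hCM (cmPointedPencilStandardA_of_homNum hD)

/-- **… and the exactness that goes with it: granted `h₂₁` and [hom ≡ num on the CM-pointed total spaces], `HC_AV ↔ HC_CM`**
(forward: part VII's fact-free `HC_AV → HC_CM ∧ F_CM`; backward: the row above) — i.e. that displayed hypothesis is one more
sufficient complement of `HC_CM` inside `HC_AV`. No converse (`HC_AV ⟹` hom ≡ num on the total spaces) is claimed or used.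
[cite: Andre1996Motifs, §6.3 (p. 33)] -/
theorem HC_AV_iff_of_andre1996_of_homNumCMPointed (h₂₁ : andre1996_cmAnchoredPencil)
    (hD : ∀ ⦃d : ℕ⦄ ⦃𝒳 S : SchemeOver ℂ⦄ (f : 𝒳 ⟶ S), IsCompactAbelianPencil f d → (cmLocus f d).Nonempty →
      ∀ (p q : ℕ) (hpq : p + q = d + 1) (_ : 2 ≤ p) (_ : p < q), ∀ y ∈ algebraicClasses 𝒳 q,
        (∀ x ∈ algebraicClasses 𝒳 p, cupProduct (show 2 * p + 2 * q = 2 * (d + 1) by omega) x y = 0) → y = 0) :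
    HodgeAbelianVarieties ↔ CMAbelianHodge :=
  ⟨fun hAV ↦ (HC_AV_iff_HC_CM_and_hodgeFailureSpreadsToCMFibre.1 hAV).1,
    fun hCM ↦ HC_AV_of_andre1996_of_HC_CM_of_homNumCMPointed h₂₁ hCM hD⟩

/-! ## §4 Under `HC_CM` (a binder): the trivial direction, by name -/

/-- **`h₂₁ → HC_CM → Num^CM → F_CM`** — trivial once XVIII-c is in the tree: ab-andre-2's `HC_AV_of_HC_CM_of_cmPointedPencilNumerical`,
then part VII's fact-free on-path `HC_AV ⟹ F_CM`. Recorded by name only; the informative rows are §1–§2 (no `HC_CM`). The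
converse under `HC_CM` HOLDS granted the classical spreading fact (§5, rev 2: ab-andre-2 XIX-b); fact-free it is not
claimed. research route, not a corollary; conditional on HC_CM plus one named minimal statement.
[cite: Andre1996Motifs, Lemme 6.3.1 (p. 31) and §6.3 (p. 33)] -/
theorem hodgeFailureSpreadsToCMFibre_of_andre1996_of_HC_CM_of_cmPointedPencilNumerical
    (h₂₁ : andre1996_cmAnchoredPencil) (hCM : CMAbelianHodge) (hNum : CMPointedPencilNumerical) :
    HodgeFailureSpreadsToCMFibre :=
  onPathAV_hodgeFailureSpreadsToCMFibre (HC_AV_of_HC_CM_of_cmPointedPencilNumerical h₂₁ hCM hNum)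

/-- **Under `HC_CM ∧ h₂₁` the column reads `A_pen^CM ⟹ Num^CM ⟹ F_CM ↔ HC_AV`** (no `hL` needed here: `HC_CM` supplies
(Perf) at the CM fibres) — the first arrow is ab-andre-2's XVIII-e (fact-free, Kleiman `A ⇒ D`), the second is §4, the
equivalence is part VII (fact-free); `HomNum_pen^CM ⟹ A_pen^CM` is ab-andre-1's XIV-d `cmPointedPencilStandardA_of_homNum`,
not restated. No arrow is reversed. [cite: Andre1996Motifs, §6.3 (p. 33)] [cite: Kleiman1968AlgebraicCycles, §3 Cor. 3.9] -/
theorem numericalColumn_of_andre1996_of_HC_CM (h₂₁ : andre1996_cmAnchoredPencil) (hCM : CMAbelianHodge) :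
    (CMPointedPencilStandardA → CMPointedPencilNumerical) ∧ (CMPointedPencilNumerical → HodgeFailureSpreadsToCMFibre) ∧
      (HodgeFailureSpreadsToCMFibre ↔ HodgeAbelianVarieties) :=
  ⟨cmPointedPencilNumerical_of_cmPointedPencilStandardA,
    hodgeFailureSpreadsToCMFibre_of_andre1996_of_HC_CM_of_cmPointedPencilNumerical h₂₁ hCM,
    ⟨fun hF ↦ HC_AV_iff_HC_CM_and_hodgeFailureSpreadsToCMFibre.2 ⟨hCM, hF⟩,
      fun hAV ↦ (HC_AV_iff_HC_CM_and_hodgeFailureSpreadsToCMFibre.1 hAV).2⟩⟩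

/-! ## §5 (rev 2) Granted the classical curve-base spreading fact: under `HC_CM` the floor IS the numerical node

Ab-andre-2's parts XIX-a/b (`Ring2AbelianAllAndreSpreadLift`, `Ring2AbelianAllAndreSpreadNumerical`; landed 2026-08-20,
before rev 1 of this file was filed) prove — modulo the classical curve-base spreading of fibrewise algebraic classes, the
Literature named fact `hSp : HodgeTheory.spread_algebraicClasses_over_smoothCurve` ("classical; see the PROOF of
[Voisin II, Thm. 10.19] and [Charles–Schnell, proof of Prop. 11.3.11]"; displayed BY NAME below as in their XIX-d, never
discharged here), and André's Lemme 6.3.1 `h₂₁` — that `(4) ⟺ (L)`, `HC_AV ⟹ (L)`, `HC_AV ⟹ Num^CM`, hence that Num^CM,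
(L), (L∀) are EXACT complements of `HC_CM`. The rows below put this next to the floor F_CM (part VII: exact, fact-free).
Count once — the content is theirs; the compositions and the Frame-grammar readings are this file's. Nothing in §5 is
fact-free: edge labels K[Spread] / K[h₂₁, Spread] / K[hL, h₂₁, Spread]. 'Minimal' is claimed for nothing. -/

/-- **Frame grammar (LEAD's `Ring2AbelianAllFrame`): Num^CM, (L), (L∀) are EXACT complements of `HC_CM`, granted Lemme 6.3.1
and the spreading fact BY NAME** — ab-andre-2's `HC_AV_iff_HC_CM_and_cmPointedPencilNumerical` (XIX-b),
`HC_AV_iff_HC_CM_and_cmFibreAlgebraicLift`, `HC_AV_iff_HC_CM_and_algebraicFixedPart` (XIX-a), read as `ExactWithCM _` (count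
once: theirs). `h₂₁`, `hSp` BINDERS (named facts). [cite: Andre1996Motifs, Lemme 6.3.1 (p. 31) and Remarque 2 (p. 33)]
[cite: VoisinHodgeII2003, §3.3.1 and §10.2.1, proof of Thm. 10.19] [cite: Kleiman1968AlgebraicCycles, §3 (D(X))] -/
theorem exactWithCM_liftNodes_of_andre1996_of_spread (h₂₁ : andre1996_cmAnchoredPencil)
    (hSp : spread_algebraicClasses_over_smoothCurve) :
    ExactWithCM CMPointedPencilNumerical ∧ ExactWithCM CMFibreAlgebraicLift ∧ ExactWithCM AlgebraicFixedPart :=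
  ⟨HC_AV_iff_HC_CM_and_cmPointedPencilNumerical h₂₁ hSp, HC_AV_iff_HC_CM_and_cmFibreAlgebraicLift h₂₁ hSp,
    HC_AV_iff_HC_CM_and_algebraicFixedPart h₂₁ hSp⟩

/-- **THE CONVERSE ROW under `HC_CM`, granted the spreading fact: `hSp → HC_CM → F_CM → Num^CM`** (no `h₂₁`, no `hL`):
F_CM closes with `HC_CM` fact-free (part VII `HC_AV_of_HC_CM_and_hodgeFailureSpreadsToCMFibre`), and Num^CM is ON PATH from
`HC_AV` granted spreading (ab-andre-2 XIX-b `cmPointedPencilNumerical_of_HC_AV`: `HC` of the abelian fibres, spread over the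
curve, then Hodge theory at the CM fibre). `HC_CM`, `hSp` BINDERS. research route, not a corollary; conditional on HC_CM plus
one named minimal statement. [cite: CharlesSchnell2014Notes, Cor. 11.3.6 and proof of Prop. 11.3.11]
[cite: Kleiman1968AlgebraicCycles, §3 (D(X))] -/
theorem cmPointedPencilNumerical_of_spread_of_HC_CM_of_hodgeFailureSpreadsToCMFibre
    (hSp : spread_algebraicClasses_over_smoothCurve) (hCM : CMAbelianHodge) (hF : HodgeFailureSpreadsToCMFibre) :
    CMPointedPencilNumerical :=
  cmPointedPencilNumerical_of_HC_AV hSp (HC_AV_of_HC_CM_and_hodgeFailureSpreadsToCMFibre hCM hF)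

/-- **Under `HC_CM`: `F_CM ⟺ Num^CM`, granted Lemme 6.3.1 and the spreading fact** (`→` the row above, which needs no `h₂₁`;
`←` §4). `HC_CM`, `h₂₁`, `hSp` BINDERS. [cite: Andre1996Motifs, §6.3 (p. 33)]
[cite: VoisinHodgeII2003, §10.2.1, proof of Thm. 10.19] -/
theorem hodgeFailureSpreadsToCMFibre_iff_cmPointedPencilNumerical_of_andre1996_of_spread_of_HC_CM
    (h₂₁ : andre1996_cmAnchoredPencil) (hSp : spread_algebraicClasses_over_smoothCurve) (hCM : CMAbelianHodge) :
    HodgeFailureSpreadsToCMFibre ↔ CMPointedPencilNumerical :=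
  ⟨cmPointedPencilNumerical_of_spread_of_HC_CM_of_hodgeFailureSpreadsToCMFibre hSp hCM,
    hodgeFailureSpreadsToCMFibre_of_andre1996_of_HC_CM_of_cmPointedPencilNumerical h₂₁ hCM⟩

/-- **Part XI §C EXTENDED by a new theorem (part XI is untouched): under `HC_CM`, modulo Lemme 6.3.1 and the spreading fact,
the floor IS each lift-side exact node — `F_CM ⟺ Num^CM`, `F_CM ⟺ (L)`, `F_CM ⟺ (L∀)`** (two exact complements of `HC_CM`
agree under `HC_CM`, Frame `iff_of_exactWithCM_of_HC_CM`). With part XI §C the list of nodes the floor coincides with under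
`HC_CM` reads (2), (3c), (R631), (4), (T∃), CPS_∃, CPS_CM [mod h₂₁] and Num^CM, (L), (L∀) [mod h₂₁, Spread]; A_pen, B_pen,
(5), HomNum stay OUTSIDE it (not known on path from `HC_AV`; part XI header (b), §3 above). `HC_CM`, `h₂₁`, `hSp` BINDERS.
[cite: Andre1996Motifs, Lemme 6.3.1 and Remarque 2 (pp. 31–33)] [cite: VoisinHodgeII2003, §10.2.1, proof of Thm. 10.19] -/
theorem floor_iff_liftNodes_of_andre1996_of_spread_of_HC_CM (h₂₁ : andre1996_cmAnchoredPencil)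
    (hSp : spread_algebraicClasses_over_smoothCurve) (hCM : CMAbelianHodge) :
    (HodgeFailureSpreadsToCMFibre ↔ CMPointedPencilNumerical) ∧ (HodgeFailureSpreadsToCMFibre ↔ CMFibreAlgebraicLift) ∧
      (HodgeFailureSpreadsToCMFibre ↔ AlgebraicFixedPart) :=
  have hF := exactWithCM_hodgeFailureSpreadsToCMFibre
  have hE := exactWithCM_liftNodes_of_andre1996_of_spread h₂₁ hSp
  ⟨iff_of_exactWithCM_of_HC_CM hF hE.1 hCM, iff_of_exactWithCM_of_HC_CM hF hE.2.1 hCM,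
    iff_of_exactWithCM_of_HC_CM hF hE.2.2 hCM⟩

/-- **The item, two readings — `(HC_CM → F_CM) ⟺ (HC_CM → Num^CM)`, granted Lemme 6.3.1 and the spreading fact**: both sides
are `CMToAbelian` (part VII `modCM_hodgeFailureSpreadsToCMFibre_iff_cmToAbelian`, fact-free; ab-andre-2 XIX-b
`cmToAbelian_iff_HC_CM_imp_cmPointedPencilNumerical`, K[h₂₁, Spread]). Nothing closes the item: stmt-HodgeConjecture-16267
stays OPEN. [cite: Andre1996Motifs, Remarque 2 (p. 33)] [cite: Kleiman1968AlgebraicCycles, §3 (D(X))] -/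
theorem modCM_hodgeFailureSpreadsToCMFibre_iff_modCM_cmPointedPencilNumerical_of_andre1996_of_spread
    (h₂₁ : andre1996_cmAnchoredPencil) (hSp : spread_algebraicClasses_over_smoothCurve) :
    ModCM HodgeFailureSpreadsToCMFibre ↔ ModCM CMPointedPencilNumerical :=
  modCM_hodgeFailureSpreadsToCMFibre_iff_cmToAbelian.trans
    (modCM_iff_cmToAbelian_of_exactWithCM (exactWithCM_liftNodes_of_andre1996_of_spread h₂₁ hSp).1).symm

/-- **THE B_min FRONTIER OF RECORD {F_CM, Num^CM} (REFEREE-AB R-43 (iii)) PLACED IN THE KERNEL**: `HC_CM`-FREE it is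
ORDERED — `Num^CM ⟹ F_CM` modulo [hL, h₂₁] (§2) — and UNDER `HC_CM` it COLLAPSES — `F_CM ⟺ Num^CM` modulo [h₂₁, Spread] (§5).
No `HC_CM`-free converse is claimed. 'Smaller' = below in the preorder of landed kernel edges with its modulus displayed;
'minimal' is claimed for nothing; exact is not minimal as a statement (F-ab-4, F-ab-81); B_min of record F_CM unchanged.
`hL`, `h₂₁`, `hSp` BINDERS (named facts); `HC_CM` a binder inside the second conjunct. research route, not a corollary;
conditional on HC_CM plus one named minimal statement. [cite: Lieberman1968, main theorem]
[cite: Andre1996Motifs, Lemme 6.3.1 (p. 31) and §6.3 (p. 33)] [cite: VoisinHodgeII2003, §10.2.1, proof of Thm. 10.19] -/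
theorem bminFrontier_of_lieberman_of_andre1996_of_spread
    (hL : Lieberman1968_lefschetzInvolution_algebraic_abelianVariety) (h₂₁ : andre1996_cmAnchoredPencil)
    (hSp : spread_algebraicClasses_over_smoothCurve) :
    (CMPointedPencilNumerical → HodgeFailureSpreadsToCMFibre) ∧
      (CMAbelianHodge → (HodgeFailureSpreadsToCMFibre ↔ CMPointedPencilNumerical)) :=
  ⟨hodgeFailureSpreadsToCMFibre_of_lieberman_of_andre1996_of_cmPointedPencilNumerical hL h₂₁,
    hodgeFailureSpreadsToCMFibre_iff_cmPointedPencilNumerical_of_andre1996_of_spread_of_HC_CM h₂₁ hSp⟩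

/-! ## §6 (rev 3) The §5 rows re-keyed to Verdier's generic local triviality (ab-andre-2 XX-a/b; count once — theirs)

Ab-andre-2's parts XX-a/b (`Ring2AbelianAllAndreSpreadVerdier[Graded]`, landed 2026-08-20T22:0xZ, after rev 2) prove the
André axis's spreading INPUT on its own carriers (`exists_algebraic_lift_of_verdier`: over a smooth projective curve, a class
algebraic on EVERY fibre agrees fibrewise with ONE algebraic class of the smooth projective total space) from the Literature
named fact `hGT : Motives.Verdier1976_genericLocalTriviality` ALONE (already load-bearing in the tree), and re-key their
XIX-a/b rows to K[Verdier]; their XX-b §5 is `HC_CM ⊢ F_CM ⟺ Num^CM` [h₂₁, Verdier], CALLED BY NAME below. Displayed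
binders `h₂₁`, `hGT` (`hL` in the frontier row); NOTHING here is fact-free; `hSp` of §5 is not derived from Verdier. -/

/-- **Frame grammar, granted Lemme 6.3.1 and Verdier BY NAME: Num^CM, (L), (L∀) are EXACT complements of `HC_CM`** —
ab-andre-2's XX-a §3 rows `HC_AV_iff_HC_CM_and_{cmPointedPencilNumerical, cmFibreAlgebraicLift, algebraicFixedPart}_of_verdier`
read as `ExactWithCM _` (count once: theirs). `h₂₁`, `hGT` BINDERS. [cite: Andre1996Motifs, Lemme 6.3.1 (p. 31), Remarque 2 (p. 33)]
[cite: Verdier1976, Thm. (4.14) and Cor. (5.1)] [cite: Kleiman1968AlgebraicCycles, §3 (D(X))] -/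
theorem exactWithCM_liftNodes_of_andre1996_of_verdier (h₂₁ : andre1996_cmAnchoredPencil)
    (hGT : Verdier1976_genericLocalTriviality) :
    ExactWithCM CMPointedPencilNumerical ∧ ExactWithCM CMFibreAlgebraicLift ∧ ExactWithCM AlgebraicFixedPart :=
  ⟨HC_AV_iff_HC_CM_and_cmPointedPencilNumerical_of_verdier h₂₁ hGT,
    HC_AV_iff_HC_CM_and_cmFibreAlgebraicLift_of_verdier h₂₁ hGT, HC_AV_iff_HC_CM_and_algebraicFixedPart_of_verdier h₂₁ hGT⟩

/-- **Part XI §C EXTENDED, Verdier-keyed (part XI and §5 untouched): under `HC_CM`, modulo Lemme 6.3.1 and Verdier, the floor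
IS each lift-side exact node — `F_CM ⟺ Num^CM` (ab-andre-2 XX-b §5, BY NAME), `F_CM ⟺ (L)`, `F_CM ⟺ (L∀)`** (two exact
complements of `HC_CM` agree under `HC_CM`, Frame `iff_of_exactWithCM_of_HC_CM`). `HC_CM`, `h₂₁`, `hGT` BINDERS.
[cite: Andre1996Motifs, Lemme 6.3.1 and Remarque 2 (pp. 31–33)] [cite: Verdier1976, Cor. (5.1)] -/
theorem floor_iff_liftNodes_of_andre1996_of_verdier_of_HC_CM (h₂₁ : andre1996_cmAnchoredPencil)
    (hGT : Verdier1976_genericLocalTriviality) (hCM : CMAbelianHodge) :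
    (HodgeFailureSpreadsToCMFibre ↔ CMPointedPencilNumerical) ∧ (HodgeFailureSpreadsToCMFibre ↔ CMFibreAlgebraicLift) ∧
      (HodgeFailureSpreadsToCMFibre ↔ AlgebraicFixedPart) :=
  have hF := exactWithCM_hodgeFailureSpreadsToCMFibre
  have hE := exactWithCM_liftNodes_of_andre1996_of_verdier h₂₁ hGT
  ⟨hodgeFailureSpreadsToCMFibre_iff_cmPointedPencilNumerical_of_HC_CM_of_verdier hCM h₂₁ hGT,
    iff_of_exactWithCM_of_HC_CM hF hE.2.1 hCM, iff_of_exactWithCM_of_HC_CM hF hE.2.2 hCM⟩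

/-- **The item, two readings, Verdier-keyed — `(HC_CM → F_CM) ⟺ (HC_CM → Num^CM)`, granted Lemme 6.3.1 and Verdier**: both
sides are `CMToAbelian` (part VII `modCM_hodgeFailureSpreadsToCMFibre_iff_cmToAbelian`, fact-free; ab-andre-2 XX-a
`cmToAbelian_iff_HC_CM_imp_cmPointedPencilNumerical_of_verdier`, K[h₂₁, Verdier]). Nothing closes the item:
stmt-HodgeConjecture-16267 stays OPEN. [cite: Andre1996Motifs, Remarque 2 (p. 33)] [cite: Verdier1976, Cor. (5.1)] -/
theorem modCM_hodgeFailureSpreadsToCMFibre_iff_modCM_cmPointedPencilNumerical_of_andre1996_of_verdier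
    (h₂₁ : andre1996_cmAnchoredPencil) (hGT : Verdier1976_genericLocalTriviality) :
    ModCM HodgeFailureSpreadsToCMFibre ↔ ModCM CMPointedPencilNumerical :=
  modCM_hodgeFailureSpreadsToCMFibre_iff_cmToAbelian.trans
    (modCM_iff_cmToAbelian_of_exactWithCM (exactWithCM_liftNodes_of_andre1996_of_verdier h₂₁ hGT).1).symm

/-- **THE B_min FRONTIER OF RECORD {F_CM, Num^CM} ON THE AXIS'S FACTS OF RECORD {hL, h₂₁, Verdier}**: `HC_CM`-FREE it is
ORDERED — `Num^CM ⟹ F_CM` modulo [hL, h₂₁] (§2) — and UNDER `HC_CM` it COLLAPSES — `F_CM ⟺ Num^CM` modulo [h₂₁, Verdier]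
(ab-andre-2 XX-b §5, by name; count once: theirs). No `HC_CM`-free converse claimed; 'minimal' claimed for nothing (F-ab-4,
F-ab-81); B_min of record F_CM unchanged. `hL`, `h₂₁`, `hGT` BINDERS (named facts); `HC_CM` a binder inside the second
conjunct. research route, not a corollary; conditional on HC_CM plus one named minimal statement. [cite: Lieberman1968,
main theorem] [cite: Andre1996Motifs, Lemme 6.3.1 (p. 31) and §6.3 (p. 33)] [cite: Verdier1976, Thm. (4.14) and Cor. (5.1)] -/
theorem bminFrontier_of_lieberman_of_andre1996_of_verdier
    (hL : Lieberman1968_lefschetzInvolution_algebraic_abelianVariety) (h₂₁ : andre1996_cmAnchoredPencil)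
    (hGT : Verdier1976_genericLocalTriviality) :
    (CMPointedPencilNumerical → HodgeFailureSpreadsToCMFibre) ∧
      (CMAbelianHodge → (HodgeFailureSpreadsToCMFibre ↔ CMPointedPencilNumerical)) :=
  ⟨hodgeFailureSpreadsToCMFibre_of_lieberman_of_andre1996_of_cmPointedPencilNumerical hL h₂₁,
    fun hCM ↦ hodgeFailureSpreadsToCMFibre_iff_cmPointedPencilNumerical_of_HC_CM_of_verdier hCM h₂₁ hGT⟩

end Summit.HodgeConjecture.HodgeConjecture.Ring2.AbelianAll
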